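/- Width seat `ym-line-sfw-p2-w5` (prover-ym-line-sfw-p2-w5-g18-0), free hands on planner ym-idea-2 g16's LINE-19 task board
(crux `AllWindowsColdBox.BoxHighWindowsSU22` = stmt-QuantumFields-24004 / low item 24335, stub S4b bootstrap, T3 companion):
the typed interface `ImVecSqLeCost` of the bootstrap kit, PROVED, with the exact su(2)-coordinate identities behind it. -/
import Summits.QuantumFields.YangMills.Theorems.AllWindowsColdBoxBoxHighLineHodgeBootstrap
import Literature.MathematicalPhysics.QuantumLattice.SU2Haar

/-!
# LINE-19 S4b bootstrap, T3 companion: `Σ_c (imVec P c)² = 1 − (Re P₀₀)² ≤ 2 − Re tr P` for `P ∈ SU(2)` (`ImVecSqLeCost` proved)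

For `P ∈ SU(2)` write `P = [[α, −β̄],[β, ᾱ]]` (`|α|² + |β|² = 1`); the su(2)-coordinates of the bootstrap kit are
`imVec P = (Im α, Re β, Im β)` (✓`…BoxHighLineHodgeBootstrap`).  This file proves the elementary identities the T3/T5 provers need:

* `re_sq_add_sum_imVec_sq` : `(Re P₀₀)² + Σ_c (imVec P c)² = 1` (unitarity of the first column);
* `apply_zero_one_eq_neg_conj` : `P₀₁ = −conj P₁₀` (the tree's `su2_apply_10`/`su2_apply_11` of `Literature…SU2Haar` are REUSED for
  `P₁₀`, `P₁₁`), hence `trace_re_eq` : `Re tr P = 2·Re P₀₀`;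
* `sum_imVec_sq_eq`        : `Σ_c (imVec P c)² = 1 − (Re P₀₀)²`, `abs_re_apply_zero_zero_le_one`, `abs_imVec_le_one`;
* **`imVecSqLeCost : ImVecSqLeCost`** — `Σ_c (imVec P c)² ≤ 2 − Re tr P` (indeed `2 − Re tr P − Σ = (1 − Re P₀₀)² ≥ 0`), the typed
  T3 companion of the kit, now a theorem; and the converse comparison on the hemisphere `Re P₀₀ ≥ 0`:
  `half_cost_le_sum_imVec_sq` : `(2 − Re tr P)/2 ≤ Σ_c (imVec P c)²` — so on the small-field/gauge-ball events the vector part and the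
  link cost `2 − Re tr` are equivalent size measures (`½·cost ≤ |imVec|² ≤ cost`).

Everything proved; no definition; standard axioms.  HONEST LABEL: an S-sized helper toward ONE registered stub (S4b) of a critic-PASSed line
on the R2ξ″ RECORD-rung crux 24004 / 24335; no stub is proved by name, no crux, rung or summit is proved; the Yang–Mills mass gap is NOT proved
by this file.
-/

set_option autoImplicit false

noncomputable section

open Matrix

namespace Summit.QuantumFields.YangMills.Theorems.AllWindowsColdBoxBoxHighLine

/-- Unitarity of the first column: `(Re P₀₀)² + (Im P₀₀)² + (Re P₁₀)² + (Im P₁₀)² = 1`, i.e. `(Re P₀₀)² + Σ_c (imVec P c)² = 1`. -/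
theorem re_sq_add_sum_imVec_sq (P : SU2) :
    ((P : Matrix (Fin 2) (Fin 2) ℂ) 0 0).re ^ 2 + ∑ c : Fin 3, imVec P c ^ 2 = 1 := by
  obtain ⟨hU, -⟩ := Matrix.mem_specialUnitaryGroup_iff.mp P.prop
  have h1 : star (P : Matrix (Fin 2) (Fin 2) ℂ) * (P : Matrix (Fin 2) (Fin 2) ℂ) = 1 := Matrix.mem_unitaryGroup_iff'.mp hU
  have h00 := congrArg (fun M : Matrix (Fin 2) (Fin 2) ℂ => (M 0 0).re) h1
  simp only [Matrix.mul_apply, Fin.sum_univ_two, Matrix.star_apply, Complex.star_def, Complex.add_re, Complex.mul_re,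
    Complex.conj_re, Complex.conj_im, Matrix.one_apply_eq, Complex.one_re] at h00
  simp only [imVec, Fin.sum_univ_three, Matrix.cons_val_zero, Matrix.cons_val_one, Matrix.cons_val_two, Matrix.head_cons,
    Matrix.tail_cons]
  nlinarith [h00]

/-- `P₀₁ = −conj P₁₀` for `P ∈ SU(2)` (from the tree's `su2_apply_10 : P₁₀ = −conj P₀₁`, `Literature…SU2Haar`). -/
theorem apply_zero_one_eq_neg_conj (P : SU2) :
    (P : Matrix (Fin 2) (Fin 2) ℂ) 0 1 = -(starRingEnd ℂ) ((P : Matrix (Fin 2) (Fin 2) ℂ) 1 0) := by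
  rw [Literature.MathematicalPhysics.QuantumLattice.su2_apply_10 P, map_neg, Complex.conj_conj, neg_neg]

/-- `Re tr P = 2·Re P₀₀` for `P ∈ SU(2)`. -/
theorem trace_re_eq (P : SU2) :
    ((P : Matrix (Fin 2) (Fin 2) ℂ).trace).re = 2 * ((P : Matrix (Fin 2) (Fin 2) ℂ) 0 0).re := by
  rw [Matrix.trace_fin_two, Complex.add_re, Literature.MathematicalPhysics.QuantumLattice.su2_apply_11, Complex.conj_re]
  ring

/-- `Σ_c (imVec P c)² = 1 − (Re P₀₀)²`. -/
theorem sum_imVec_sq_eq (P : SU2) :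
    ∑ c : Fin 3, imVec P c ^ 2 = 1 - ((P : Matrix (Fin 2) (Fin 2) ℂ) 0 0).re ^ 2 := by
  linarith [re_sq_add_sum_imVec_sq P]

/-- `|Re P₀₀| ≤ 1`. -/
theorem abs_re_apply_zero_zero_le_one (P : SU2) : |((P : Matrix (Fin 2) (Fin 2) ℂ) 0 0).re| ≤ 1 := by
  have h := re_sq_add_sum_imVec_sq P
  have hs : 0 ≤ ∑ c : Fin 3, imVec P c ^ 2 := Finset.sum_nonneg fun c _ => sq_nonneg _
  exact abs_le_one_iff_mul_self_le_one.mpr (by nlinarith)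

/-- Each su(2)-coordinate is at most `1` in absolute value. -/
theorem abs_imVec_le_one (P : SU2) (c : Fin 3) : |imVec P c| ≤ 1 := by
  have h := re_sq_add_sum_imVec_sq P
  have hc : imVec P c ^ 2 ≤ ∑ c' : Fin 3, imVec P c' ^ 2 :=
    Finset.single_le_sum (f := fun c' => imVec P c' ^ 2) (fun c' _ => sq_nonneg _) (Finset.mem_univ c)
  exact abs_le_one_iff_mul_self_le_one.mpr (by nlinarith [sq_nonneg ((P : Matrix (Fin 2) (Fin 2) ℂ) 0 0).re])

/-- **`ImVecSqLeCost` proved**: `Σ_c (imVec P c)² ≤ 2 − Re tr P` for every `P ∈ SU(2)` (`2 − Re tr P − Σ = (1 − Re P₀₀)²`). -/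
theorem imVecSqLeCost : ImVecSqLeCost := by
  intro P
  rw [sum_imVec_sq_eq, trace_re_eq]
  nlinarith [sq_nonneg (1 - ((P : Matrix (Fin 2) (Fin 2) ℂ) 0 0).re)]

/-- The exact defect of the inequality: `(2 − Re tr P) − Σ_c (imVec P c)² = (1 − Re P₀₀)²`. -/
theorem cost_sub_sum_imVec_sq_eq (P : SU2) :
    (2 - ((P : Matrix (Fin 2) (Fin 2) ℂ).trace).re) - ∑ c : Fin 3, imVec P c ^ 2 =
      (1 - ((P : Matrix (Fin 2) (Fin 2) ℂ) 0 0).re) ^ 2 := by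
  rw [sum_imVec_sq_eq, trace_re_eq]
  ring

/-- Converse comparison on the hemisphere `Re P₀₀ ≥ 0` (which contains every link of cost `< 2`): `(2 − Re tr P)/2 ≤ Σ_c (imVec P c)²`.
So `½·cost ≤ |imVec|² ≤ cost` there. -/
theorem half_cost_le_sum_imVec_sq (P : SU2) (hP : 0 ≤ ((P : Matrix (Fin 2) (Fin 2) ℂ) 0 0).re) :
    (2 - ((P : Matrix (Fin 2) (Fin 2) ℂ).trace).re) / 2 ≤ ∑ c : Fin 3, imVec P c ^ 2 := by
  rw [sum_imVec_sq_eq, trace_re_eq]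
  have h1 : ((P : Matrix (Fin 2) (Fin 2) ℂ) 0 0).re ≤ 1 := (abs_le.mp (abs_re_apply_zero_zero_le_one P)).2
  nlinarith

/-- A link of cost `< 2` lies in the hemisphere `Re P₀₀ > 0`. -/
theorem re_apply_zero_zero_pos_of_cost_lt_two (P : SU2) (h : 2 - ((P : Matrix (Fin 2) (Fin 2) ℂ).trace).re < 2) :
    0 < ((P : Matrix (Fin 2) (Fin 2) ℂ) 0 0).re := by
  rw [trace_re_eq] at h
  linarith

end Summit.QuantumFields.YangMills.Theorems.AllWindowsColdBoxBoxHighLine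

end
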